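import Mathlib
import Literature.MathematicalPhysics.QuantumFieldTheory.MagnenRivasseauSeneor1993.MRS93StartingAnsatz
import Literature.MathematicalPhysics.QuantumFieldTheory.MagnenRivasseauSeneor1993.MRS93MainStatementPinned
import Literature.MathematicalPhysics.QuantumFieldTheory.MagnenRivasseauSeneor1993.MRS93AnisotropicSlicing
import HarnessLib

/-!
# Magnen–Rivasseau–Sénéor (CMP 155, 1993): the two Gaussian REFERENCE MEASURES of the bare ansatz — `dμ_{0,ρ₁}`
# («the Gaussian measure with propagator C₀(p)κ_{ρ₁}(p)», (II.18) p.332) and `dν_{ρ₂}` («the Gaussian measure on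
# γ with covariance Γ_{ρ₂}», (II.36) p.339) — typed CONCRETELY on the pinned momentum-lattice carrier, and the
# Gaussian reference model of the pinned interface

statement-level skeleton of published definitions with citation tags; bookkeeping proved; nothing here is a claim
about the Yang–Mills mass gap, about continuum Yang–Mills on `T⁴` without infrared cutoff, or about the Clay problem —
and nothing of Magnen–Rivasseau–Sénéor's analysis is asserted or formalised

**Citation header (reproduction of PUBLISHED work).** J. Magnen, V. Rivasseau, R. Sénéor, *Construction of YM₄ with
an infrared cutoff*, Commun. Math. Phys. **155** (1993) 325–383 [MagnenRivasseauSeneor1993], Sect. II.A pp.328–333,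
Sect. II.B (II.36) p.339, (II.44)–(II.49) pp.341–342, (II.78) p.347. Loci `p.NNN tl.nn` = journal page / text-layer
line of the held scan `paper:magnen1993-cmp155-mrs-ym4-infrared-cutoff` (PDF page = journal page − 324); displays
read on the decoded page images (renders of record `run/shared/lean/pub/lit-balaban/inprint/lit-balaban-p14/
renders-cmp155/p08_full_s6.png`, `p15_full_s6.png`, `p17_full_s6.png`, `p18_full_s6.png`, and the crop
`renders/p15_crop_r3000-3700_s2.png` of (II.36) in the seat folder of unit `pub-balaban-gaps-mrs-lit-1`, gen 2).
Cell pub-balaban-gaps, track G3, seat mrs-lit-1; companion prose `run/shared/lean/pub/pub-balaban-gaps/g3/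
MRS-AS-PRINTED.md` §2, §5. Builds on `…MRS93StartingAnsatz` (κ, κ_ρ, κ^i, (II.12)), `…MRS93MainStatementPinned`
(the pinned carrier `Momentum`, `Mode`, `Config`, `monomial`, `Parameters`, `PinnedTheory`, the predicate
`PinnedTheory.PrintedStatement`) and `…MRS93AnisotropicSlicing` (`Momentum.norm`).

**Why this file.** The cell's §D row 1 for MRS reads «quote faithful; carrier PINNED; construction NOT typed;
vacuity frontier proved in-file» (BALABAN-GAPS.md v0.4.4). Of the bare ansatz (II.78) = `Σ_LFR ∫ dμ_{0,ρ₁}(A′)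
dν_{ρ₂}(γ) χ_LFR(A) G(A′,γ) e^{…} … [K_{ρ,ρ₂}]⁻¹ … L_{0,ρ₁}(γ)F(A′₀,γ)` (p.347 tl.2–7) the two ingredients that are
MEASURES — the Gaussian reference measures `dμ_{0,ρ₁}` and `dν_{ρ₂}`, against which everything else is a density —
are definition-complete in print. This file types THEM concretely (as `MeasureTheory.Measure`s on the pinned
coordinates), so that «construction NOT typed» becomes «reference measures typed; the density factors not», and uses
them to inhabit the pinned interface by a genuine, non-degenerate field law. (Of the density factors, some are
explicit field polynomials/exponentials in print — `e^{(1/2)(−F²_sp − ⟨A,p₀²A⟩ + Σλ²⟨A,p²κ^iA⟩)}`, the cutoff factor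
`e^{−(1/2)⟨A′,[(κ_ρ)⁻¹−1](p²)A′⟩}`, `G(A′,γ)` (II.45), the damping `e^{−Σ_i((λ_i^t)^{1/2+2ε₂}γ^i)^N}` with «e.g.
N = 100» — but live on position-space products of the fields and are not typed here; the others — `χ_LFR` (the
outcome of the expansions (II.25)/(II.29a)), `K_{ρ,ρ₂}` (II.76), `CT_ρ` (III.1) with (III.2) asymptotic and `b_ρ`
by a fixed point (p.347 tl.36–40), `L_{0,ρ₁}F` (II.46)–(II.47) with `N′` «some large integer» — are not
definition-complete in print.)

**What the paper prints (verbatim).**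
* (II.16) p.332 tl.3–4: *«Σ_i (λ_i^t)²⟨A, p²κ^i(p)A⟩ = ⟨A, C₀⁻¹A⟩»*; (II.17) tl.8–9: *«dμ₀ is the normalized
  Gaussian measure with propagator C₀»*; (II.18) tl.16–21: *«We could write instead of (II.17) the functional
  measure of the theory as: dμ_{0,ρ₁}(A) e^{(1/2)(−F²_sp − ⟨A,p₀²A⟩ + Σ_i(λ_i^t)²⟨A,(p²κ^i(p))A⟩)} … where dμ_{0,ρ₁}
  is the Gaussian measure with propagator C₀(p)κ_{ρ₁}(p), and the sum over i in (II.18) stops at ρ₁»*.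
* p.328 tl.12–15: *«The momentum space corresponds to discrete Fourier analysis on the dual lattice Λ* = ℤ⁴.
  Moreover the constant fields or the zero mode in Fourier space is deleted in all our functional integrals»*;
  tl.37–40: *«we define a scalar product ⟨A, B⟩ … by the convention that a trace is taken over all correspondent
  space time indices and minus a trace over group indices, so that it is positive definite with a factor 1/2 in
  component notation»*.
* (II.36) p.339 tl.22–24 (image): *«Hence we choose as propagator Γ_{ρ₂}(p) = Σ_{i=1}^{ρ₂} Γ^i_{ρ₂}(p),
  Γ^i_{ρ₂}(p) = Σ_{i=1}^{ρ₂} (λ_i^t)^{−(1+2ε₂)} κ^i(p)/p⁴, (II.36) where ρ₂ ≪ ρ₁. The Gaussian measure on γ with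
  covariance Γ_{ρ₂} is called dν_{ρ₂}(γ).»* — the second display re-sums its own index `i` [sic]; READ
  `Γ^i_{ρ₂}(p) = (λ_i^t)^{−(1+2ε₂)} κ^i(p)/p⁴` (typed both ways: `ghostSlice`/`ghostCovariance` = reading,
  `ghostCovariancePrinted` = literal, `ghostCovariancePrinted_eq`: literal = `ρ₂ ×` reading).
* (II.44) p.341 tl.35–37: *«Let us consider again dμ_{0,ρ₁}(A) which is the initial normalized Gaussian measure with
  propagator C_{0,ρ₁} used to define our functional integral over A»*; p.342 tl.5–6: *«Our initial axial field A
  has only nine scalar components since A₀ was identically 0. We want that the special-gauge field A′ contains the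
  usual twelve components»*; (II.46) p.342: *«1 = L_{0,ρ₁}(γ) ∫ dμ_{C₀,ρ₁}(A′₀) F(A′₀, γ)»*.

**What is typed here (definitions with bodies; bookkeeping kernel-checked, zero `sorry`, zero named facts).**
* §1 the reality structure of the momentum lattice: `Momentum.neg`, a decidable half-lattice `Momentum.IsPos`
  (first nonzero coordinate positive — OURS, the print fixes no representative of `{p, −p}`), with
  `isPos_or_isPos_neg` / `not_isPos_neg_of_isPos` (exactly one of `p, −p` is positive).
* §2 GENERIC real Gaussian fields on `Momentum × L → ℝ` (label type `L`): `modeGaussian v` = the countable product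
  `⊗_m 𝒩(0, v m)` (Mathlib `Measure.infinitePi`, `ProbabilityTheory.gaussianReal`), `realify im` (the reality
  constraint `Ã(−p) = conj Ã(p)`: a coordinate at a non-positive momentum is `±` the one at `−p`), and
  **`gaussianFieldLaw im v := (modeGaussian v).map (realify im)`**. PROVED: probability; every coordinate monomial
  is integrable (`integrable_gmonomial_gaussianFieldLaw`, via `|Π_j a_j| ≤ Σ_j |a_j|^N` and Gaussian moments
  `memLp_id_gaussianReal`); a moment depends only on the variances of the finitely many coordinates it contains
  (`integral_gmonomial_modeGaussian_congr`, by `Measure.infinitePi_map_restrict`), hence **mode-wise eventually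
  constant variances give convergent moments** (`tendsto_integral_gmonomial_gaussianFieldLaw`); a monomial with a
  variance-`0` coordinate integrates to `0`; `∫ X_m² = v m` (`integral_sq_eval`).
* §3 the PRINTED covariances from the named parameters of `…Pinned.Parameters`: `Parameters.invC0 ρ₁ |p| =
  p² Σ_{i≤ρ₁} (λ_i^t)² κ^i(|p|)` ((II.16) with (II.12) inserted; `invC0_eq_ansatz`: it is `Ansatz.invC0` of
  `…StartingAnsatz` §6), **`muZeroCovariance ρ₁ |p| = κ_{ρ₁}(|p|) · C₀(p)`** (the printed propagator of
  `dμ_{0,ρ₁}`; `= 0` beyond `(3 + η⁻¹)M^{ρ₁}`), `ghostSlice`/`ghostCovariance` ((II.36), reading) and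
  `ghostCovariancePrinted(_eq)` (literal); mode variances `muZeroVariance` (axial `A`: nine components, time
  variance `0`), `muZeroVariance'` (twelve-component `A′`), `nuVariance`; the measures **`muZero par ρ₁ : Measure
  Config`** = `dμ_{0,ρ₁}(A)`, `muZeroPrime` = `dμ_{0,ρ₁}(A′)dμ_{C₀,ρ₁}(A′₀)`, **`nu par ρ₂ : Measure GhostConfig`** =
  `dν_{ρ₂}(γ)` on `GhostMode = Momentum × Fin 3 × Bool`; PROVED: probability, all moments finite, and the diagonal
  two-point function **`integral_sq_muZero`** `∫ Ã_m² dμ_{0,ρ₁} = muZeroVariance ρ₁ m` (so `dμ_{0,ρ₁}` is NOT the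
  zero-field law wherever `κ_{ρ₁}C₀ > 0`).
* §4 **`gaussianRefModel par …`**: the interface `PinnedTheory` INHABITED by `⟨·⟩_{ax,ρ} := dμ_{0,ρ₁(ρ)}(A)` with
  the named parameters (the structure's proof obligations — probability, integrability of every monomial, axial
  vanishing — PROVED, none assumed); `gaussianRefModel_schwinger_two`; **`gaussianRefModel_uvLimit`**: its ultraviolet limit EXISTS in the
  sense of `UVLimitExistsPrinted` — PROVED by `muZeroCovariance_stable` (once `M^R ≥ |p|`, `κ_{ρ₁}(|p|) = 1` and the
  slices above `R` vanish at `|p|`, so the propagator at `p` is the same for all `ρ₁ ≥ R`) and `ρ₁(ρ) > ρ`;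
  `gaussianRefModel_Slim` (the limit moments are those of `dμ_{0,∞}`, variances `muZeroVarianceLim`); with `E_N :=`
  the Ward functional of the limit moments (`gaussianRefModelE`) the pinned printed statement HOLDS
  (`gaussianRefModelE_printedStatement`), whence `exists_pinnedTheory_gaussianRef`.
* §5 (v1.1, same seat, append-only) THE FULL TWO-POINT FUNCTION: `integral_mul_eval_of_ne` (distinct independent
  coordinates are uncorrelated, via `Measure.infinitePi_map_restrict` + `integral_fintype_prod_eq_prod`),
  `integral_mul_gaussianFieldLaw_of_rep_ne` / `_of_rep_eq`, and **`integral_mul_muZero`**: `∫ Ã_m Ã_{m′} dμ_{0,ρ₁}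
  = 0` unless `m, m′` have the same label and equal-or-opposite momenta, `= ± muZeroVariance ρ₁ m` then (sign `−`
  exactly for the imaginary parts at `p, −p`: the reality constraint); `integral_mul_nu` likewise — i.e. «propagator
  `C₀(p)κ_{ρ₁}(p)`» / «covariance `Γ_{ρ₂}`» read, at second order and in full, as translation-invariant real Gaussian
  fields diagonal in the labels.
* §6 (v1.1) THE TRUE CUTOFF ON THE REFERENCE STRUCTURE: `Parameters.trueCutoffCovariance ρ ρ₁` = the symbol
  `[(C₀κ_{ρ₁})⁻¹ + (κ_ρ⁻¹ − 1)p²]⁻¹` of the normalised product `dμ_{0,ρ₁}(A′) · e^{−(1/2)⟨A′,[(κ_ρ)⁻¹−1](p²)A′⟩}` of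
  the first two `A′`-factors of (II.78) (OUR Gaussian algebra, declared — the paper does the same in words for
  (II.18)/(II.19)), `muTrueCutoff par ρ ρ₁ : Measure Config`; PROVED: `= 0` beyond `(3 + η⁻¹)M^ρ` (the TRUE cutoff
  suppresses the mode), `= C₀(p)κ_{ρ₁}(p)` below `M^ρ`, `trueCutoffCovariance_stable`, and
  **`tendsto_integral_monomial_muTrueCutoff`**: every moment converges as the TRUE cutoff `ρ → ∞` (`ρ₁ = ρ₁(ρ)`).

**Readings (declared).** (i)–(v) as in `…StartingAnsatz` / `…AnisotropicSlicing` (natural scale indices; symbols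
radial in `|p|`, the Euclidean length of `p ∈ ℤ⁴ ∖ {0}` AS PRINTED — a `2π` in the characters of `Λ* = ℤ⁴`, which the
print does not write, would rescale constants only). (vi) NORMALISATION of the mode variances: «Gaussian measure
with propagator C» is read, as is standard, as the centred Gaussian whose covariance in the authors' scalar product
is `C`: `E⟨A,f⟩⟨A,g⟩ = ⟨f, Cg⟩`; with *«a factor 1/2 in component notation»* (p.328 tl.40) the component covariance
is `E[Ã^a_m(p) conj Ã^b_n(q)] = 2C(p)δ_{ab}δ_{mn}δ_{pq}` (unit volume), and for a REAL field the real and imaginary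
parts of `Ã^a_m(p)` are independent with half that variance each — so `Var(Re Ã^a_m(p)) = Var(Im Ã^a_m(p)) = C(p)`,
which is what `muZeroVariance`/`nuVariance` set; modes at distinct positive momenta and distinct labels independent
(translation invariance + `C₀⁻¹`, `Γ_{ρ₂}` scalar in colour/Lorentz indices, (II.16)/(II.36)). A different
convention changes every variance by one common positive factor and nothing else below. (vii) `Real.toNNReal`
clips the printed propagator at `0`: for parameter values with `(λ_i^t)² < 0` in (II.12) (excluded by «C is a large
constant», p.330 tl.21) or where `κ_{ρ₁} = 0` there is no Gaussian to speak of and the typed variance is `0` —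
junk values, flagged, never used in a theorem with content. (viii) `dμ_{0,ρ₁}(A)` for the AXIAL field has nine
components (p.342 tl.5–6): time coordinates get variance `0` (`muZeroVariance`); the twelve-component variant for
`A′` ((II.44)–(II.46)) is `muZeroVariance'`/`muZeroPrime`.

**Honest status / what is NOT claimed.** `muZero`, `muZeroPrime`, `nu` are the REFERENCE Gaussian measures of
(II.18)/(II.35)/(II.39)/(II.44)–(II.49)/(II.78); the DENSITY FACTORS of the bare ansatz — `χ_LFR` (II.25)–(II.35),
`G(A′,γ)` (II.45), `K_{ρ₂}`/`K_{ρ,ρ₂}` (II.37)/(II.76), the cutoff factor `e^{−(1/2)⟨A′,[(κ_ρ)⁻¹−1](p²)A′⟩}`, `CT_ρ`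
(III.1), `L_{0,ρ₁}F` (II.46)–(II.47), `e^{−Σ(λ^{1/2+2ε₂}γ^i)^N}`, the positive exponential of (II.18) — are NOT
typed (the explicit ones would need position-space fields, i.e. Fourier series of the lattice modes, their products
and box integrals; the others are not definition-complete in print: `b_ρ` by a fixed point p.347 tl.36–40, (III.2)
asymptotic, `N′` «some large integer», LFR from the expansions; see `…Pinned` docstring), nor is the normalizability
of (II.78) (part of the printed sketch).
`gaussianRefModel` is NEITHER MRS's interacting theory NOR its `λ → 0` limit: `⟨A, C₀⁻¹A⟩` is *«add[ed] and
subtract[ed]»* (p.331 tl.18–19), *«only a technical trick»* (p.332 tl.34) — `dμ_{0,ρ₁}` is bookkeeping, and so is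
this model. What §4 establishes is exactly: the pinned interface is consistent with a genuine Gaussian field law
built from the printed covariance, and the printed predicate (convergence of moments + (VIII.6) with `E_N`
unconstrained in print) holds for it — the vacuity frontier of `…Pinned` (`diracModel_mainStatement`) restated with
a non-degenerate witness; removing it needs the density factors, i.e. MRS's analysis, which nobody has typed.
Nothing here is continuum Yang–Mills on `T⁴`, nothing lifts the infrared cutoff, nothing is about Bałaban's
programme.
-/

noncomputable section

open MeasureTheory ProbabilityTheory Filter Topology Finset
open scoped NNReal ENNReal

namespace Literature.MathematicalPhysics.QuantumFieldTheory.MagnenRivasseauSeneor1993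

namespace MainStatement

open Ansatz

/-! ## §1 The reality structure of the momentum lattice: `p ↦ −p` and a choice of half-lattice -/

namespace Momentum

/-- `−p` (nonzero with `p`). [cite: MagnenRivasseauSeneor1993, §II.A p.328 tl.12–13] -/
def neg (p : Momentum) : Momentum := ⟨-p.1, fun h => p.2 (neg_eq_zero.mp h)⟩

/-- Components of `−p`. [cite: MagnenRivasseauSeneor1993, §II.A p.328 tl.12–13] -/
@[simp] theorem neg_apply (p : Momentum) (μ : Fin 4) : p.neg.1 μ = -p.1 μ := rfl

/-- `−(−p) = p`. [cite: MagnenRivasseauSeneor1993, §II.A p.328 tl.12–13] -/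
@[simp] theorem neg_neg (p : Momentum) : p.neg.neg = p := by
  apply Subtype.ext
  funext μ
  simp [neg]

/-- A half-lattice of representatives of the pairs `{p, −p}`: `p` is POSITIVE iff its first nonzero coordinate is
positive (ours; the print fixes no such choice — it is the bookkeeping behind «Ã(−p) = conj Ã(p)» for a REAL field
`A`). [cite: MagnenRivasseauSeneor1993, §II.A p.328 tl.12–17] -/
def IsPos (p : Momentum) : Prop := ∃ μ : Fin 4, 0 < p.1 μ ∧ ∀ ν, ν < μ → p.1 ν = 0

/-- Positivity is decidable. [cite: MagnenRivasseauSeneor1993, §II.A p.328] -/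
instance IsPos.decidable : DecidablePred IsPos := fun p => by
  unfold IsPos; infer_instance

/-- Exactly one of `p`, `−p` is positive — existence half: every nonzero lattice momentum or its negative is
positive. [cite: MagnenRivasseauSeneor1993, §II.A p.328 tl.12–15] -/
theorem isPos_or_isPos_neg (p : Momentum) : p.IsPos ∨ p.neg.IsPos := by
  classical
  have hne : ∃ μ, p.1 μ ≠ 0 := by
    by_contra h
    exact p.2 (funext fun μ => not_not.mp (not_exists.mp h μ))
  obtain ⟨μ, hμ, hmin⟩ : ∃ μ, p.1 μ ≠ 0 ∧ ∀ ν, ν < μ → p.1 ν = 0 := by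
    let s : Finset (Fin 4) := Finset.univ.filter (fun μ => p.1 μ ≠ 0)
    have hs : s.Nonempty := by
      obtain ⟨μ, h⟩ := hne
      exact ⟨μ, by simp [s, h]⟩
    refine ⟨s.min' hs, (Finset.mem_filter.mp (s.min'_mem hs)).2, fun ν hν => ?_⟩
    by_contra h
    exact absurd (s.min'_le ν (by simp [s, h])) (not_le.mpr hν)
  rcases lt_or_gt_of_ne hμ with h | h
  · right
    exact ⟨μ, by simpa using h, fun ν hν => by simp [hmin ν hν]⟩
  · left
    exact ⟨μ, h, hmin⟩

/-- … uniqueness half: `p` and `−p` are never both positive. [cite: MagnenRivasseauSeneor1993, §II.A p.328 tl.12–15] -/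
theorem not_isPos_neg_of_isPos {p : Momentum} (h : p.IsPos) : ¬ p.neg.IsPos := by
  rintro ⟨μ', h', hmin'⟩
  obtain ⟨μ, hμ, hmin⟩ := h
  simp only [neg_apply, Left.neg_pos_iff, neg_eq_zero] at h' hmin'
  rcases lt_trichotomy μ μ' with hlt | rfl | hgt
  · have := hmin' μ hlt; omega
  · omega
  · have := hmin μ' hgt; omega

end Momentum

/-! ## §2 Real Gaussian random fields on the momentum lattice with independent modes (generic in the label type
`L`: `L = Fin 4 × Fin 3 × Bool` for the vector potential, `L = Fin 3 × Bool` for the field `γ`) -/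

section generic

variable {L : Type*}

/-- The representative of the coordinate `m = (p, ℓ)`: itself if `p` is positive, else the coordinate at `−p`.
[cite: MagnenRivasseauSeneor1993, §II.A p.328 tl.12–17] -/
def rep (m : Momentum × L) : Momentum × L := if m.1.IsPos then m else (m.1.neg, m.2)

/-- The sign relating a coordinate to its representative: `Re Ã(−p) = Re Ã(p)`, `Im Ã(−p) = −Im Ã(p)` for a real
field (`im ℓ` tells whether the label `ℓ` is an imaginary part). [cite: MagnenRivasseauSeneor1993, §II.A p.328 tl.12–17] -/
def sgn (im : L → Bool) (m : Momentum × L) : ℝ := if m.1.IsPos then 1 else if im m.2 then -1 else 1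

/-- `sgn = ±1`. [cite: MagnenRivasseauSeneor1993, §II.A p.328] -/
theorem sgn_sq (im : L → Bool) (m : Momentum × L) : sgn im m ^ 2 = 1 := by
  unfold sgn; split_ifs <;> norm_num

/-- REALIFICATION: from independent coordinates `X` (used only at positive momenta) to a configuration obeying the
reality constraint of the Fourier transform of a real field, `A(p, ℓ) = ± X(rep (p, ℓ))`.
[cite: MagnenRivasseauSeneor1993, §II.A p.328 tl.12–17] -/
def realify (im : L → Bool) (X : Momentum × L → ℝ) : Momentum × L → ℝ := fun m => sgn im m * X (rep m)

/-- Realification is measurable (each output coordinate is `±` an input coordinate).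
[cite: MagnenRivasseauSeneor1993, §II.A p.328] -/
theorem measurable_realify (im : L → Bool) : Measurable (realify im) := by
  refine measurable_pi_lambda _ fun m => ?_
  show Measurable fun X : Momentum × L → ℝ => sgn im m * X (rep m)
  exact Measurable.mul measurable_const (measurable_pi_apply (rep m))

/-- Coordinate monomials `X ↦ Π_j X(f j)` on a generic label type (for `L = Fin 4 × Fin 3 × Bool` this is
`MainStatement.monomial` of `…MRS93MainStatementPinned`, definitionally). [cite: MagnenRivasseauSeneor1993, (VIII.1) p.377] -/
def gmonomial {N : ℕ} (f : Fin N → Momentum × L) (X : Momentum × L → ℝ) : ℝ := ∏ j, X (f j)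

/-- Monomials are measurable. [cite: MagnenRivasseauSeneor1993, (VIII.1) p.377] -/
theorem measurable_gmonomial {N : ℕ} (f : Fin N → Momentum × L) : Measurable (gmonomial f) := by
  unfold gmonomial
  exact Finset.measurable_prod _ fun j _ => measurable_pi_apply (f j)

/-- A monomial of the realified field is `±` the monomial of the representatives.
[cite: MagnenRivasseauSeneor1993, §II.A p.328 and (VIII.1) p.377] -/
theorem gmonomial_realify (im : L → Bool) {N : ℕ} (f : Fin N → Momentum × L) (X : Momentum × L → ℝ) :
    gmonomial f (realify im X) = (∏ j, sgn im (f j)) * gmonomial (rep ∘ f) X := by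
  unfold gmonomial realify
  rw [← Finset.prod_mul_distrib]
  rfl

/-- INDEPENDENT CENTRED GAUSSIAN COORDINATES with variances `v`: the countable product
`⊗_m 𝒩(0, v m)` (Mathlib `Measure.infinitePi`, `gaussianReal`; `v m = 0` gives the Dirac mass at `0`).
[cite: MagnenRivasseauSeneor1993, (II.17)–(II.18) p.332] -/
def modeGaussian (v : Momentum × L → ℝ≥0) : Measure (Momentum × L → ℝ) :=
  Measure.infinitePi fun m => gaussianReal 0 (v m)

/-- It is a probability measure. [cite: MagnenRivasseauSeneor1993, (II.17) p.332 tl.9 («normalized»)] -/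
instance modeGaussian.isProbabilityMeasure (v : Momentum × L → ℝ≥0) :
    IsProbabilityMeasure (modeGaussian v) := by
  unfold modeGaussian; infer_instance

/-- THE REAL GAUSSIAN FIELD LAW with mode variances `v`: independent centred Gaussians at the positive momenta,
realified. [cite: MagnenRivasseauSeneor1993, (II.17)–(II.18) p.332] -/
def gaussianFieldLaw (im : L → Bool) (v : Momentum × L → ℝ≥0) : Measure (Momentum × L → ℝ) :=
  (modeGaussian v).map (realify im)

/-- It is a probability measure. [cite: MagnenRivasseauSeneor1993, (II.17) p.332 tl.9] -/
instance gaussianFieldLaw.isProbabilityMeasure (im : L → Bool) (v : Momentum × L → ℝ≥0) :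
    IsProbabilityMeasure (gaussianFieldLaw im v) :=
  Measure.isProbabilityMeasure_map (measurable_realify im).aemeasurable

/-- Every power of a coordinate is integrable (Gaussian moments are finite).
[cite: MagnenRivasseauSeneor1993, (II.17)–(II.18) p.332] -/
theorem integrable_pow_eval (v : Momentum × L → ℝ≥0) (m : Momentum × L) (n : ℕ) :
    Integrable (fun X : Momentum × L → ℝ => X m ^ n) (modeGaussian v) := by
  have h : Integrable (fun x : ℝ => x ^ n) (gaussianReal 0 (v m)) := by
    rcases Nat.eq_zero_or_pos n with rfl | hn
    · simp only [pow_zero]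
      exact integrable_const 1
    · have hm : MemLp id (n : ℝ≥0∞) (gaussianReal 0 (v m)) := by
        have := memLp_id_gaussianReal (μ := 0) (v := v m) (n : ℝ≥0)
        simpa using this
      have h1 : Integrable (fun x : ℝ => ‖x ^ n‖) (gaussianReal 0 (v m)) := by
        simpa [norm_pow] using hm.integrable_norm_pow hn.ne'
      exact (integrable_norm_iff (by fun_prop)).mp h1
  have h2 : Integrable (fun x : ℝ => x ^ n) ((modeGaussian v).map (fun X => X m)) := by
    rw [modeGaussian, Measure.infinitePi_map_eval]
    exact h
  exact h2.comp_measurable (measurable_pi_apply m)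

/-- Elementary domination used for integrability: `|Π_j a_j| ≤ Σ_j |a_j|^N` for `N ≥ 1` factors.
[cite: MagnenRivasseauSeneor1993, (VIII.1) p.377] -/
theorem abs_prod_le_sum_pow {N : ℕ} (hN : 0 < N) (a : Fin N → ℝ) : |∏ j, a j| ≤ ∑ j, |a j| ^ N := by
  obtain ⟨j₀, -, hj₀⟩ := Finset.exists_max_image Finset.univ (fun j => |a j|)
    (Finset.univ_nonempty_iff.mpr ⟨⟨0, hN⟩⟩)
  rw [Finset.abs_prod]
  calc ∏ j, |a j| ≤ ∏ _j : Fin N, |a j₀| :=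
        Finset.prod_le_prod (fun j _ => abs_nonneg _) (fun j _ => hj₀ j (Finset.mem_univ j))
    _ = |a j₀| ^ N := by simp
    _ ≤ ∑ j, |a j| ^ N :=
        Finset.single_le_sum (f := fun j => |a j| ^ N) (fun j _ => pow_nonneg (abs_nonneg _) _)
          (Finset.mem_univ j₀)

/-- Every coordinate monomial is integrable for the independent Gaussian coordinates.
[cite: MagnenRivasseauSeneor1993, (II.17)–(II.18) p.332 and (VIII.1) p.377] -/
theorem integrable_gmonomial_modeGaussian (v : Momentum × L → ℝ≥0) {N : ℕ} (f : Fin N → Momentum × L) :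
    Integrable (gmonomial f) (modeGaussian v) := by
  rcases Nat.eq_zero_or_pos N with rfl | hN
  · have : gmonomial f = fun _ => 1 := by funext X; simp [gmonomial]
    rw [this]
    exact integrable_const 1
  · refine Integrable.mono' (g := fun X => ∑ j, |X (f j)| ^ N) ?_
      (measurable_gmonomial f).aestronglyMeasurable (Eventually.of_forall fun X => ?_)
    · refine integrable_finsetSum _ fun j _ => ?_
      have := (integrable_pow_eval v (f j) N).abs
      exact this.congr (Eventually.of_forall fun X => by simp [abs_pow])
    · rw [Real.norm_eq_abs]
      exact abs_prod_le_sum_pow hN _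

/-- … and for the real Gaussian field law. [cite: MagnenRivasseauSeneor1993, (II.17)–(II.18) p.332 and (VIII.1) p.377] -/
theorem integrable_gmonomial_gaussianFieldLaw (im : L → Bool) (v : Momentum × L → ℝ≥0) {N : ℕ}
    (f : Fin N → Momentum × L) : Integrable (gmonomial f) (gaussianFieldLaw im v) := by
  unfold gaussianFieldLaw
  refine (integrable_map_measure (measurable_gmonomial f).aestronglyMeasurable
    (measurable_realify im).aemeasurable).mpr ?_
  have : gmonomial f ∘ realify im = fun X => (∏ j, sgn im (f j)) * gmonomial (rep ∘ f) X := by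
    funext X; exact gmonomial_realify im f X
  rw [this]
  exact (integrable_gmonomial_modeGaussian v (rep ∘ f)).const_mul _

/-- The expectation of a monomial of the independent coordinates depends on the variances of the coordinates it
contains only (marginal on finitely many coordinates = finite product, `Measure.infinitePi_map_restrict`).
[cite: MagnenRivasseauSeneor1993, (II.17)–(II.18) p.332] -/
theorem integral_gmonomial_modeGaussian_congr {v v' : Momentum × L → ℝ≥0} {N : ℕ}
    (f : Fin N → Momentum × L) (h : ∀ j, v (f j) = v' (f j)) :
    ∫ X, gmonomial f X ∂(modeGaussian v) = ∫ X, gmonomial f X ∂(modeGaussian v') := by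
  classical
  let I : Finset (Momentum × L) := Finset.univ.image f
  have hmem : ∀ j, f j ∈ I := fun j => Finset.mem_image_of_mem f (Finset.mem_univ j)
  let g : (I → ℝ) → ℝ := fun y => ∏ j, y ⟨f j, hmem j⟩
  have hg : Measurable g := Finset.measurable_prod _ fun j _ => measurable_pi_apply _
  have key : ∀ w : Momentum × L → ℝ≥0, ∫ X, gmonomial f X ∂(modeGaussian w) =
      ∫ y, g y ∂(Measure.pi fun i : I => gaussianReal 0 (w i)) := by
    intro w
    have e := integral_map (μ := modeGaussian w) (Finset.measurable_restrict I).aemeasurable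
      (f := g) hg.aestronglyMeasurable
    change ∫ X, g (I.restrict X) ∂(modeGaussian w) = _
    rw [← e, modeGaussian, Measure.infinitePi_map_restrict]
  have hF : (fun i : I => gaussianReal 0 (v i)) = fun i : I => gaussianReal 0 (v' i) := by
    funext i
    obtain ⟨j, -, hj⟩ := Finset.mem_image.mp i.2
    rw [← hj, h j]
  rw [key, key, hF]

/-- The expectation of a monomial of the real Gaussian field: `±` the expectation of the monomial of the
representatives. [cite: MagnenRivasseauSeneor1993, (II.17)–(II.18) p.332 and (VIII.1) p.377] -/
theorem integral_gmonomial_gaussianFieldLaw (im : L → Bool) (v : Momentum × L → ℝ≥0) {N : ℕ}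
    (f : Fin N → Momentum × L) :
    ∫ A, gmonomial f A ∂(gaussianFieldLaw im v) =
      (∏ j, sgn im (f j)) * ∫ X, gmonomial (rep ∘ f) X ∂(modeGaussian v) := by
  unfold gaussianFieldLaw
  rw [integral_map (measurable_realify im).aemeasurable (measurable_gmonomial f).aestronglyMeasurable]
  simp_rw [gmonomial_realify]
  exact integral_const_mul _ _

/-- Hence it depends on the variances of the representatives of the coordinates it contains only.
[cite: MagnenRivasseauSeneor1993, (II.17)–(II.18) p.332] -/
theorem integral_gmonomial_gaussianFieldLaw_congr (im : L → Bool) {v v' : Momentum × L → ℝ≥0} {N : ℕ}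
    (f : Fin N → Momentum × L) (h : ∀ j, v (rep (f j)) = v' (rep (f j))) :
    ∫ A, gmonomial f A ∂(gaussianFieldLaw im v) = ∫ A, gmonomial f A ∂(gaussianFieldLaw im v') := by
  rw [integral_gmonomial_gaussianFieldLaw, integral_gmonomial_gaussianFieldLaw,
    integral_gmonomial_modeGaussian_congr (rep ∘ f) h]

/-- MODE-WISE EVENTUALLY CONSTANT VARIANCES GIVE CONVERGENT MOMENTS: if along a sequence of variance profiles
`v ρ` every coordinate's variance is eventually equal to `vlim`, every moment of the field converges (it is
eventually constant). This is the mechanism of the ultraviolet limit of the reference model (§4).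
[cite: MagnenRivasseauSeneor1993, p.327 tl.39–41] -/
theorem tendsto_integral_gmonomial_gaussianFieldLaw (im : L → Bool) (v : ℕ → Momentum × L → ℝ≥0)
    (vlim : Momentum × L → ℝ≥0) (hv : ∀ m, ∀ᶠ ρ in atTop, v ρ m = vlim m) {N : ℕ}
    (f : Fin N → Momentum × L) :
    Tendsto (fun ρ => ∫ A, gmonomial f A ∂(gaussianFieldLaw im (v ρ))) atTop
      (𝓝 (∫ A, gmonomial f A ∂(gaussianFieldLaw im vlim))) := by
  have hev : ∀ᶠ ρ in atTop, ∀ j, v ρ (rep (f j)) = vlim (rep (f j)) :=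
    eventually_all.mpr fun j => hv _
  exact tendsto_const_nhds.congr'
    (hev.mono fun ρ hρ => (integral_gmonomial_gaussianFieldLaw_congr im f hρ).symm)

/-- A monomial containing a coordinate of variance `0` has expectation `0` (that coordinate is a.s. `0`).
[cite: MagnenRivasseauSeneor1993, (II.7) p.329 and (II.17)–(II.18) p.332] -/
theorem integral_gmonomial_modeGaussian_eq_zero {v : Momentum × L → ℝ≥0} {N : ℕ}
    (f : Fin N → Momentum × L) {j₀ : Fin N} (h0 : v (f j₀) = 0) :
    ∫ X, gmonomial f X ∂(modeGaussian v) = 0 := by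
  apply integral_eq_zero_of_ae
  have hae : ∀ᵐ X ∂(modeGaussian v), X (f j₀) = 0 := by
    have hmap : (modeGaussian v).map (fun X => X (f j₀)) = Measure.dirac 0 := by
      rw [modeGaussian, Measure.infinitePi_map_eval, h0, gaussianReal_zero_var]
    have : ∀ᵐ x ∂((modeGaussian v).map (fun X => X (f j₀))), x = 0 := by
      rw [hmap, ae_dirac_eq]
      exact eventually_pure.mpr rfl
    exact ae_of_ae_map (measurable_pi_apply _).aemeasurable this
  filter_upwards [hae] with X hX
  simp only [gmonomial, Pi.zero_apply]
  exact Finset.prod_eq_zero (Finset.mem_univ j₀) hX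

/-- The second moment of a coordinate is its variance. [cite: MagnenRivasseauSeneor1993, (II.17)–(II.18) p.332] -/
theorem integral_sq_eval (v : Momentum × L → ℝ≥0) (m : Momentum × L) :
    ∫ X, X m ^ 2 ∂(modeGaussian v) = v m := by
  have e := integral_map (μ := modeGaussian v) (measurable_pi_apply m).aemeasurable
    (f := fun x : ℝ => x ^ 2) (by fun_prop)
  rw [← e, modeGaussian, Measure.infinitePi_map_eval]
  have hvar := variance_fun_id_gaussianReal (μ := 0) (v := v m)
  rw [variance_eq_integral measurable_id'.aemeasurable, integral_id_gaussianReal] at hvar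
  simpa using hvar

end generic

/-! ## §3 The printed covariances from the NAMED parameters: `C₀(p)κ_{ρ₁}(p)` of `dμ_{0,ρ₁}` ((II.16), (II.18)) and
`Γ_{ρ₂}(p)` of `dν_{ρ₂}` ((II.36)), and the reference measures on the pinned coordinates -/

/-- «time component» (`μ = 0`) is decidable. [cite: MagnenRivasseauSeneor1993, §II.A p.328 tl.19] -/
instance Mode.decidableIsTime (m : Mode) : Decidable m.IsTime := by
  unfold Mode.IsTime; infer_instance

namespace Parameters

variable (par : Parameters)

/-- (II.16) with the sum stopped at `ρ₁` ((II.18) p.332 tl.20–21) and (II.12) inserted: the symbol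
`C₀⁻¹(p) = p² Σ_{i=0}^{ρ₁} (λ_i^t)² κ^i(|p|)` as a function of `r = |p|`, from the named `τ, η, M, β₂, β₃, C`
(`tentativeCoupling i` IS `(λ_i^t)²` of (II.12)). [cite: MagnenRivasseauSeneor1993, (II.16) p.332 tl.3–4 and (II.18) p.332 tl.18–21] -/
def invC0 (ρ₁ : ℕ) (r : ℝ) : ℝ :=
  r ^ 2 * ∑ i ∈ Finset.range (ρ₁ + 1), par.tentativeCoupling i * sliceCutoff par.τ par.η par.M i r

/-- It is the symbol `Ansatz.invC0` of `…MRS93StartingAnsatz` §6 evaluated at `p² = r²` with `λ_i^t = √((λ_i^t)²)`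
(for nonnegative squared couplings, i.e. «C large»). [cite: MagnenRivasseauSeneor1993, (II.16) p.332] -/
theorem invC0_eq_ansatz (ρ₁ : ℕ) {r : ℝ} (hr : 0 ≤ r) (hlam : ∀ i, 0 ≤ par.tentativeCoupling i) :
    par.invC0 ρ₁ r =
      Ansatz.invC0 par.τ par.η par.M (fun i => Real.sqrt (par.tentativeCoupling i)) ρ₁ (r ^ 2) := by
  unfold invC0 Ansatz.invC0
  rw [Real.sqrt_sq hr]
  congr 1
  refine Finset.sum_congr rfl fun i _ => ?_
  rw [Real.sq_sqrt (hlam i)]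

/-- THE PROPAGATOR OF `dμ_{0,ρ₁}`: *«dμ_{0,ρ₁} is the Gaussian measure with propagator C₀(p)κ_{ρ₁}(p)»* (p.332
tl.20), as a function of `r = |p|` (`x⁻¹ = 0` at `x = 0` is Lean's convention; it only matters where `κ_{ρ₁} = 0`
anyway, `muZeroCovariance_eq_zero_of_ge`). [cite: MagnenRivasseauSeneor1993, (II.18) p.332 tl.16–21] -/
def muZeroCovariance (ρ₁ : ℕ) (r : ℝ) : ℝ := par.uvCutoff ρ₁ r * (par.invC0 ρ₁ r)⁻¹

/-- Beyond the fake cutoff, `|p| ≥ (3 + η⁻¹)M^{ρ₁}`, the propagator vanishes: `dμ_{0,ρ₁}` carries no such modes.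
[cite: MagnenRivasseauSeneor1993, (II.13)–(II.14) p.331 and (II.18) p.332] -/
theorem muZeroCovariance_eq_zero_of_ge (ρ₁ : ℕ) {r : ℝ} (hr : (3 + par.η⁻¹) * (par.M : ℝ) ^ ρ₁ ≤ r) :
    par.muZeroCovariance ρ₁ r = 0 := by
  unfold muZeroCovariance
  rw [(par.uvCutoff_eq_one_and_zero ρ₁).2 hr, zero_mul]

/-- (II.36), READING: `Γ_{ρ₂}(p) = Σ_{i=1}^{ρ₂} Γ^i_{ρ₂}(p)`, `Γ^i_{ρ₂}(p) = (λ_i^t)^{−(1+2ε₂)} κ^i(p)/p⁴` — the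
slice `Γ^i_{ρ₂}` as a function of `r = |p|`, with `(λ_i^t)^{−(1+2ε₂)} = ((λ_i^t)²)^{−(1+2ε₂)/2}` from the named squared
couplings. AS PRINTED the second display carries a spurious inner sum, *«Γ^i_{ρ₂}(p) = Σ_{i=1}^{ρ₂}
(λ_i^t)^{−(1+2ε₂)} κ^i(p)/p⁴»* (the bound index `i` re-summed) — see `ghostCovariancePrinted`.
[cite: MagnenRivasseauSeneor1993, (II.36) p.339 tl.22–24] -/
def ghostSlice (i : ℕ) (r : ℝ) : ℝ :=
  par.tentativeCoupling i ^ (-(1 + 2 * par.ε₂) / 2) * sliceCutoff par.τ par.η par.M i r / r ^ 4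

/-- `Γ_{ρ₂} = Σ_{i=1}^{ρ₂} Γ^i_{ρ₂}` (READING of (II.36)). [cite: MagnenRivasseauSeneor1993, (II.36) p.339 tl.22–24] -/
def ghostCovariance (ρ₂ : ℕ) (r : ℝ) : ℝ := ∑ i ∈ Finset.Icc 1 ρ₂, par.ghostSlice i r

/-- (II.36) LITERALLY: with the inner sum as printed, `Γ^i_{ρ₂}` does not depend on `i` and
`Γ_{ρ₂} = Σ_{i=1}^{ρ₂} (Σ_{i=1}^{ρ₂} …)`. [cite: MagnenRivasseauSeneor1993, (II.36) p.339 tl.22–24] -/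
def ghostCovariancePrinted (ρ₂ : ℕ) (r : ℝ) : ℝ :=
  ∑ _i ∈ Finset.Icc 1 ρ₂, ∑ i ∈ Finset.Icc 1 ρ₂, par.ghostSlice i r

/-- The literal print is `ρ₂` times the reading — kernel-checked record of the misprint.
[cite: MagnenRivasseauSeneor1993, (II.36) p.339 tl.22–24] -/
theorem ghostCovariancePrinted_eq (ρ₂ : ℕ) (r : ℝ) :
    par.ghostCovariancePrinted ρ₂ r = ρ₂ * par.ghostCovariance ρ₂ r := by
  unfold ghostCovariancePrinted ghostCovariance
  rw [Finset.sum_const, Nat.card_Icc, nsmul_eq_mul]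
  simp

/-- The mode variances of `dμ_{0,ρ₁}(A)` on the pinned coordinates (K1) of `…MRS93MainStatementPinned`: the real
and imaginary parts of `Ã^a_m(p)` for spatial `m` have variance `C₀(p)κ_{ρ₁}(|p|)` (READING (vi) of the module
docstring: normalisation), the time components (axial field, `A₀ = 0`, (II.7); *«Our initial axial field A has only
nine scalar components»*, p.342 tl.5–6) variance `0`. [cite: MagnenRivasseauSeneor1993, (II.18) p.332, (II.7) p.329, p.342 tl.5–6] -/
def muZeroVariance (ρ₁ : ℕ) (m : Mode) : ℝ≥0 :=
  if m.IsTime then 0 else (par.muZeroCovariance ρ₁ m.1.norm).toNNReal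

/-- The same without the axial constraint: the twelve-component field `A′` of (II.44)–(II.48) (*«the special-gauge
field A′ contains the usual twelve components»*, p.342 tl.5–6; `A′₀` created by `dμ_{C₀,ρ₁}(A′₀)`, (II.46)).
[cite: MagnenRivasseauSeneor1993, (II.44) p.341, (II.46) p.342] -/
def muZeroVariance' (ρ₁ : ℕ) (m : Mode) : ℝ≥0 := (par.muZeroCovariance ρ₁ m.1.norm).toNNReal

/-- Time components have variance `0`. [cite: MagnenRivasseauSeneor1993, (II.7) p.329] -/
theorem muZeroVariance_of_isTime (ρ₁ : ℕ) {m : Mode} (h : m.IsTime) : par.muZeroVariance ρ₁ m = 0 := if_pos h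

end Parameters

/-- Coordinates of the field `γ` (values in su(2): colour index `a ∈ Fin 3`; real/imaginary part of `γ̃^a(p)`).
[cite: MagnenRivasseauSeneor1993, (II.20) p.333 tl.29, tl.35–37 and (II.36) p.339] -/
abbrev GhostMode : Type := Momentum × Fin 3 × Bool

/-- Configurations of `γ` in these coordinates. [cite: MagnenRivasseauSeneor1993, (II.36) p.339] -/
abbrev GhostConfig : Type := GhostMode → ℝ

/-- The imaginary-part flag of a vector-potential label `(μ, a, b)`. [cite: MagnenRivasseauSeneor1993, §II.A p.328] -/
def modeIm (ℓ : Fin 4 × Fin 3 × Bool) : Bool := ℓ.2.2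

/-- The imaginary-part flag of a `γ` label `(a, b)`. [cite: MagnenRivasseauSeneor1993, (II.36) p.339] -/
def ghostIm (ℓ : Fin 3 × Bool) : Bool := ℓ.2

/-- The mode variances of `dν_{ρ₂}(γ)`: real and imaginary parts of `γ̃^a(p)` with variance `Γ_{ρ₂}(|p|)`
(READING (vi)). [cite: MagnenRivasseauSeneor1993, (II.36) p.339 tl.22–24] -/
def Parameters.nuVariance (par : Parameters) (ρ₂ : ℕ) (m : GhostMode) : ℝ≥0 :=
  (par.ghostCovariance ρ₂ m.1.norm).toNNReal

/-- **`dμ_{0,ρ₁}(A)`** — *«the Gaussian measure with propagator C₀(p)κ_{ρ₁}(p)»* for the axial field, as a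
probability measure on the pinned configurations `Config` (realified independent Gaussian modes, §2).
[cite: MagnenRivasseauSeneor1993, (II.18) p.332 tl.16–21, (II.35) p.339, (II.39)–(II.40) p.340] -/
def muZero (par : Parameters) (ρ₁ : ℕ) : Measure Config := gaussianFieldLaw modeIm (par.muZeroVariance ρ₁)

/-- `dμ_{0,ρ₁}(A′) dμ_{C₀,ρ₁}(A′₀)` of (II.44)–(II.46): the twelve-component reference measure.
[cite: MagnenRivasseauSeneor1993, (II.44) p.341 tl.35–37, (II.46) p.342] -/
def muZeroPrime (par : Parameters) (ρ₁ : ℕ) : Measure Config := gaussianFieldLaw modeIm (par.muZeroVariance' ρ₁)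

/-- **`dν_{ρ₂}(γ)`** — *«The Gaussian measure on γ with covariance Γ_{ρ₂} is called dν_{ρ₂}(γ)»*.
[cite: MagnenRivasseauSeneor1993, (II.36) p.339 tl.22–24] -/
def nu (par : Parameters) (ρ₂ : ℕ) : Measure GhostConfig := gaussianFieldLaw ghostIm (par.nuVariance ρ₂)

/-- `dμ_{0,ρ₁}` is a probability measure («normalized», p.332 tl.9). [cite: MagnenRivasseauSeneor1993, (II.17)–(II.18) p.332] -/
instance muZero.isProbabilityMeasure (par : Parameters) (ρ₁ : ℕ) : IsProbabilityMeasure (muZero par ρ₁) := by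
  unfold muZero; infer_instance

/-- `dμ_{0,ρ₁}(A′)dμ_{C₀,ρ₁}(A′₀)` is a probability measure. [cite: MagnenRivasseauSeneor1993, (II.44)–(II.46) pp.341–342] -/
instance muZeroPrime.isProbabilityMeasure (par : Parameters) (ρ₁ : ℕ) :
    IsProbabilityMeasure (muZeroPrime par ρ₁) := by
  unfold muZeroPrime; infer_instance

/-- `dν_{ρ₂}` is a probability measure. [cite: MagnenRivasseauSeneor1993, (II.36) p.339] -/
instance nu.isProbabilityMeasure (par : Parameters) (ρ₂ : ℕ) : IsProbabilityMeasure (nu par ρ₂) := by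
  unfold nu; infer_instance

/-- The monomials of `…MRS93MainStatementPinned` are the generic ones at `L = Fin 4 × Fin 3 × Bool`.
[cite: MagnenRivasseauSeneor1993, (VIII.1) p.377] -/
theorem monomial_eq_gmonomial {N : ℕ} (f : Fin N → Mode) : monomial f = gmonomial f := rfl

/-- All moments of `dμ_{0,ρ₁}` are finite. [cite: MagnenRivasseauSeneor1993, (II.18) p.332] -/
theorem integrable_monomial_muZero (par : Parameters) (ρ₁ : ℕ) {N : ℕ} (f : Fin N → Mode) :
    Integrable (monomial f) (muZero par ρ₁) :=
  integrable_gmonomial_gaussianFieldLaw _ _ f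

/-- All moments of `dν_{ρ₂}` are finite (*«K_{ρ₂}(A) is well defined since it is a functional integral of a bounded
polynomial interaction with a Gaussian measure with ultraviolet cutoff»*, p.340 tl.10–11, starts here).
[cite: MagnenRivasseauSeneor1993, (II.36)–(II.37) p.339, p.340 tl.10–11] -/
theorem integrable_gmonomial_nu (par : Parameters) (ρ₂ : ℕ) {N : ℕ} (f : Fin N → GhostMode) :
    Integrable (gmonomial f) (nu par ρ₂) :=
  integrable_gmonomial_gaussianFieldLaw _ _ f

/-- The representative of a coordinate has the same label. [cite: MagnenRivasseauSeneor1993, §II.A p.328] -/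
theorem rep_snd {L : Type*} (m : Momentum × L) : (rep m).2 = m.2 := by
  unfold rep; split_ifs <;> rfl

/-- … and a momentum of the same length. [cite: MagnenRivasseauSeneor1993, §II.A p.328] -/
theorem norm_rep_fst {L : Type*} (m : Momentum × L) : (rep m).1.norm = m.1.norm := by
  unfold rep
  split_ifs
  · rfl
  · simp [Momentum.norm, Momentum.neg]

/-- Hence the variances of `dμ_{0,ρ₁}` are even under `p ↦ −p`: `v(rep m) = v(m)`.
[cite: MagnenRivasseauSeneor1993, (II.18) p.332] -/
theorem muZeroVariance_rep (par : Parameters) (ρ₁ : ℕ) (m : Mode) :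
    par.muZeroVariance ρ₁ (rep m) = par.muZeroVariance ρ₁ m := by
  unfold Parameters.muZeroVariance
  have h1 : Mode.IsTime (rep m) ↔ m.IsTime := by unfold Mode.IsTime; rw [rep_snd]
  rw [norm_rep_fst]
  by_cases h : m.IsTime
  · rw [if_pos h, if_pos (h1.mpr h)]
  · rw [if_neg h, if_neg (fun h' => h (h1.mp h'))]

/-- THE TWO-POINT FUNCTION OF `dμ_{0,ρ₁}` on the diagonal: `∫ Ã_m² dμ_{0,ρ₁} = v(m)` = `C₀(p)κ_{ρ₁}(|p|)` (clipped
at `0`) for a spatial coordinate, `0` for a time coordinate — in particular `dμ_{0,ρ₁}` is NOT the zero-field law.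
[cite: MagnenRivasseauSeneor1993, (II.18) p.332 tl.16–21] -/
theorem integral_sq_muZero (par : Parameters) (ρ₁ : ℕ) (m : Mode) :
    ∫ A, A m ^ 2 ∂(muZero par ρ₁) = par.muZeroVariance ρ₁ m := by
  have h := integral_gmonomial_gaussianFieldLaw modeIm (par.muZeroVariance ρ₁) ![m, m]
  have e1 : (fun A : Config => gmonomial ![m, m] A) = fun A => A m ^ 2 := by
    funext A; simp [gmonomial, Fin.prod_univ_two, sq]
  have e2 : (fun X : Config => gmonomial (rep ∘ ![m, m]) X) = fun X => X (rep m) ^ 2 := by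
    funext X; simp [gmonomial, Fin.prod_univ_two, sq]
  have e3 : (∏ j, sgn modeIm (![m, m] j)) = 1 := by
    simp [Fin.prod_univ_two, ← sq, sgn_sq]
  rw [e1, e2, e3, one_mul, integral_sq_eval, muZeroVariance_rep] at h
  exact h

/-! ## §4 The Gaussian reference model of the pinned interface and its ultraviolet limit -/

/-- A monomial of the axial reference field containing a time coordinate has expectation `0`.
[cite: MagnenRivasseauSeneor1993, (II.7) p.329, p.342 tl.5–6] -/
theorem integral_monomial_muZero_eq_zero_of_time (par : Parameters) (ρ₁ : ℕ) {N : ℕ} (f : Fin N → Mode)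
    (h : ∃ j, (f j).IsTime) : ∫ A, monomial f A ∂(muZero par ρ₁) = 0 := by
  obtain ⟨j, hj⟩ := h
  rw [monomial_eq_gmonomial, muZero, integral_gmonomial_gaussianFieldLaw,
    integral_gmonomial_modeGaussian_eq_zero (rep ∘ f) (j₀ := j) ?_, mul_zero]
  show par.muZeroVariance ρ₁ (rep (f j)) = 0
  rw [muZeroVariance_rep]
  exact par.muZeroVariance_of_isTime ρ₁ hj

/-- **The Gaussian reference model.** The pinned interface `PinnedTheory` of `…MRS93MainStatementPinned` inhabited
by a genuine (non-degenerate) field law built from the print: `⟨·⟩_{ax,ρ} := dμ_{0,ρ₁(ρ)}(A)`, the reference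
Gaussian measure of the bare ansatz at the fake cutoff `ρ₁(ρ)` of the named parameters; Ward data and `E_N` free.
HONEST STATUS: this is the REFERENCE measure of (II.35)/(II.39)/(II.78), not MRS's interacting measure (whose
eleven density factors are not typed) and not its `λ → 0` limit either (the quadratic form `⟨A, C₀⁻¹A⟩` is «added
and subtracted», p.331 tl.18–19: a bookkeeping device). [cite: MagnenRivasseauSeneor1993, (II.18) p.332, (II.78) p.347, p.327 tl.39–43] -/
def gaussianRefModel (par : Parameters) (WTest : ℕ → Type) (wardData : (N : ℕ) → WTest N → WardData)
    (E : (N : ℕ) → WTest N → ℝ) : PinnedTheory where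
  par := par
  law ρ := muZero par (par.ρ₁ ρ)
  isProb _ := inferInstance
  integrable ρ _ f := integrable_monomial_muZero par (par.ρ₁ ρ) f
  axial ρ _ f h := integral_monomial_muZero_eq_zero_of_time par (par.ρ₁ ρ) f h
  WTest := WTest
  wardData := wardData
  E := E

/-- Its two-point function on the diagonal is the printed propagator (clipped at `0`), not zero.
[cite: MagnenRivasseauSeneor1993, (II.18) p.332] -/
theorem gaussianRefModel_schwinger_two (par : Parameters) (WTest : ℕ → Type)
    (wardData : (N : ℕ) → WTest N → WardData) (E : (N : ℕ) → WTest N → ℝ) (ρ : ℕ) (m : Mode) :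
    (gaussianRefModel par WTest wardData E).schwinger ρ 2 ![m, m] = par.muZeroVariance (par.ρ₁ ρ) m := by
  unfold PinnedTheory.schwinger gaussianRefModel
  have e1 : (fun A : Config => monomial ![m, m] A) = fun A => A m ^ 2 := by
    funext A; simp [monomial, Fin.prod_univ_two, sq]
  simp only [e1]
  exact integral_sq_muZero par (par.ρ₁ ρ) m

/-- STABILISATION OF THE PROPAGATOR MODE BY MODE: once `M^R ≥ |p|`, neither `κ_{ρ₁}(|p|)` (= 1) nor
`C₀⁻¹(p)` (slices above `R` vanish at `|p|`) changes with `ρ₁ ≥ R`. [cite: MagnenRivasseauSeneor1993, (II.13)–(II.16) pp.331–332] -/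
theorem muZeroCovariance_stable (par : Parameters) {R ρ₁ : ℕ} (hR : R ≤ ρ₁) {r : ℝ}
    (hr : r ≤ (par.M : ℝ) ^ R) : par.muZeroCovariance ρ₁ r = par.muZeroCovariance R r := by
  have hM1 : (1 : ℝ) ≤ par.M := par.one_lt_M.le
  have hr' : r ≤ (par.M : ℝ) ^ ρ₁ := hr.trans (pow_le_pow_right₀ hM1 hR)
  unfold Parameters.muZeroCovariance
  rw [(par.uvCutoff_eq_one_and_zero ρ₁).1 hr', (par.uvCutoff_eq_one_and_zero R).1 hr]
  congr 2
  unfold Parameters.invC0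
  congr 1
  symm
  refine Finset.sum_subset (Finset.range_subset_range.mpr (by omega)) fun i hi hi' => ?_
  have hiR : R + 1 ≤ i := by
    rw [Finset.mem_range] at hi hi'
    omega
  obtain ⟨k, rfl⟩ : ∃ k, i = k + 1 := ⟨i - 1, by omega⟩
  rw [sliceCutoff_succ_eq_zero_of_le par.τ par.η (par.M : ℝ) hM1 k
    (hr.trans (pow_le_pow_right₀ hM1 (by omega))), mul_zero]

/-- A scale index `R(p) = ⌈|p|⌉` with `M^{R(p)} ≥ |p|` (`M ≥ 2`). [cite: MagnenRivasseauSeneor1993, (II.13) p.331] -/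
def stableIndex (m : Mode) : ℕ := ⌈m.1.norm⌉₊

/-- `|p| ≤ M^{R(p)}`. [cite: MagnenRivasseauSeneor1993, (II.13) p.331] -/
theorem norm_le_pow_stableIndex (par : Parameters) (m : Mode) :
    m.1.norm ≤ (par.M : ℝ) ^ stableIndex m := by
  have h1 : m.1.norm ≤ (stableIndex m : ℝ) := Nat.le_ceil _
  have h2 : (stableIndex m : ℝ) ≤ (par.M : ℝ) ^ stableIndex m := by
    have := Nat.lt_pow_self (n := stableIndex m) par.hM
    exact_mod_cast this.le
  exact h1.trans h2

/-- The limiting mode variances: the value at the stable index. [cite: MagnenRivasseauSeneor1993, (II.13)–(II.18) pp.331–332] -/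
def Parameters.muZeroVarianceLim (par : Parameters) (m : Mode) : ℝ≥0 := par.muZeroVariance (stableIndex m) m

/-- MODE-WISE THE REFERENCE VARIANCES ARE EVENTUALLY CONSTANT along `ρ ↦ ρ₁(ρ)` (`ρ < ρ₂(ρ) < ρ₁(ρ)`, so
`ρ₁(ρ) → ∞`). [cite: MagnenRivasseauSeneor1993, (II.13)–(II.18) pp.331–332, p.340 tl.15 («ρ ≪ ρ₂ ≪ ρ₁»)] -/
theorem muZeroVariance_eventually_eq (par : Parameters) (m : Mode) :
    ∀ᶠ ρ in atTop, par.muZeroVariance (par.ρ₁ ρ) m = par.muZeroVarianceLim m := by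
  refine eventually_atTop.mpr ⟨stableIndex m, fun ρ hρ => ?_⟩
  have hρ₁ : stableIndex m ≤ par.ρ₁ ρ := by
    have h1 := (par.hρ ρ).1
    have h2 := (par.hρ ρ).2
    omega
  unfold Parameters.muZeroVarianceLim Parameters.muZeroVariance
  rw [muZeroCovariance_stable par hρ₁ (norm_le_pow_stableIndex par m)]

/-- **The ultraviolet limit of the reference model EXISTS** (first half of the printed main statement, for the
reference Gaussian family): every moment of `dμ_{0,ρ₁(ρ)}` converges as `ρ → ∞` — it is eventually constant, the
propagator stabilising mode by mode. [cite: MagnenRivasseauSeneor1993, p.327 tl.39–41, (II.18) p.332] -/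
theorem gaussianRefModel_uvLimit (par : Parameters) (WTest : ℕ → Type)
    (wardData : (N : ℕ) → WTest N → WardData) (E : (N : ℕ) → WTest N → ℝ) :
    UVLimitExistsPrinted (gaussianRefModel par WTest wardData E).toAxialTheory := by
  intro N f
  exact ⟨_, tendsto_integral_gmonomial_gaussianFieldLaw modeIm (fun ρ => par.muZeroVariance (par.ρ₁ ρ))
    par.muZeroVarianceLim (muZeroVariance_eventually_eq par) f⟩

/-- The limit Schwinger functions of the reference model are the moments of the limiting Gaussian field
`dμ_{0,∞}` (mode variances `muZeroVarianceLim`). [cite: MagnenRivasseauSeneor1993, p.327 tl.39–41] -/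
theorem gaussianRefModel_Slim (par : Parameters) (WTest : ℕ → Type)
    (wardData : (N : ℕ) → WTest N → WardData) (E : (N : ℕ) → WTest N → ℝ) (N : ℕ) (f : Fin N → Mode) :
    (gaussianRefModel par WTest wardData E).toAxialTheory.Slim N f =
      ∫ A, monomial f A ∂(gaussianFieldLaw modeIm par.muZeroVarianceLim) :=
  tendsto_nhds_unique
    (tendsto_Slim_of_uvLimitExists (gaussianRefModel_uvLimit par WTest wardData E) N f)
    (tendsto_integral_gmonomial_gaussianFieldLaw modeIm (fun ρ => par.muZeroVariance (par.ρ₁ ρ))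
      par.muZeroVarianceLim (muZeroVariance_eventually_eq par) f)

/-- The Gaussian reference model with `E_N :=` the Ward functional of the limit moments (the choice under which the
identity (VIII.6) holds for it). [cite: MagnenRivasseauSeneor1993, (VIII.6) p.378] -/
def gaussianRefModelE (par : Parameters) (WTest : ℕ → Type) (wardData : (N : ℕ) → WTest N → WardData) :
    PinnedTheory :=
  gaussianRefModel par WTest wardData fun N x =>
    finitaryWard (fun _ f => ∫ A, monomial f A ∂(gaussianFieldLaw modeIm par.muZeroVarianceLim)) (wardData N x)

/-- THE FRONTIER RESTATED WITH A NON-DEGENERATE MODEL: with `E_N :=` the Ward functional of the limit moments, the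
reference model satisfies the pinned printed statement — the predicate sees convergence of moments and the identity
`LHS = E_N` with `E_N` unconstrained in print (*«E_N can be computed for any given infrared cutoff»*, p.378 tl.9),
not the eleven density factors of (II.78). [cite: MagnenRivasseauSeneor1993, p.327 tl.39–48, (VIII.6) p.378] -/
theorem gaussianRefModelE_printedStatement (par : Parameters) (WTest : ℕ → Type)
    (wardData : (N : ℕ) → WTest N → WardData) :
    (gaussianRefModelE par WTest wardData).PrintedStatement := by
  refine ⟨gaussianRefModel_uvLimit par WTest wardData _, fun N x => ?_⟩
  have hS : (gaussianRefModelE par WTest wardData).toAxialTheory.Slim =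
      fun _ f => ∫ A, monomial f A ∂(gaussianFieldLaw modeIm par.muZeroVarianceLim) := by
    funext n f
    exact gaussianRefModel_Slim par WTest wardData _ n f
  unfold AxialTheory.wardLHSLim
  rw [hS]
  rfl

/-- Hence the interface `IsMRSTheory` is presented, for every choice of the named parameters, by a carrier whose
two-point function is the printed reference propagator and which satisfies the printed predicate.
[cite: MagnenRivasseauSeneor1993, p.327 tl.39–48] -/
theorem exists_pinnedTheory_gaussianRef (par : Parameters) :
    ∃ P : PinnedTheory, P.par = par ∧ P.PrintedStatement ∧
      ∀ ρ (m : Mode), P.schwinger ρ 2 ![m, m] = par.muZeroVariance (par.ρ₁ ρ) m :=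
  ⟨gaussianRefModelE par (fun _ => Unit) (fun _ _ => (0, [])), rfl,
    gaussianRefModelE_printedStatement par _ _,
    fun ρ m => gaussianRefModel_schwinger_two par _ _ _ ρ m⟩

/-! ## §5 (v1.1) The full two-point function: «propagator C» means diagonal in momentum up to the reality pairing
`{p, −p}`, diagonal in the labels, with the printed value on the diagonal -/

section covariance

variable {L : Type*}

/-- Distinct independent centred coordinates are uncorrelated: `∫ X_a X_b = 0` for `a ≠ b`.
[cite: MagnenRivasseauSeneor1993, (II.17)–(II.18) p.332] -/
theorem integral_mul_eval_of_ne (v : Momentum × L → ℝ≥0) {a b : Momentum × L} (hab : a ≠ b) :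
    ∫ X, X a * X b ∂(modeGaussian v) = 0 := by
  classical
  let I : Finset (Momentum × L) := {a, b}
  have ha : a ∈ I := by simp [I]
  have hb : b ∈ I := by simp [I]
  let g : (I → ℝ) → ℝ := fun y => ∏ i, y i
  have hg : Measurable g := Finset.measurable_prod _ fun i _ => measurable_pi_apply i
  have hprod : ∀ X : Momentum × L → ℝ, g (I.restrict X) = X a * X b := by
    intro X
    show (∏ i : I, X i) = X a * X b
    rw [Finset.prod_coe_sort (s := I) (f := fun i => X i), Finset.prod_pair hab]
  have e := integral_map (μ := modeGaussian v) (Finset.measurable_restrict I).aemeasurable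
    (f := g) hg.aestronglyMeasurable
  simp only [hprod] at e
  rw [← e, modeGaussian, Measure.infinitePi_map_restrict]
  have key := integral_fintype_prod_eq_prod (𝕜 := ℝ) (fun (_ : I) (x : ℝ) => x)
    (μ := fun i : I => gaussianReal 0 (v i))
  have hzero : (∏ i : I, ∫ x, (fun (_ : I) (x : ℝ) => x) i x ∂(fun i : I => gaussianReal 0 (v i)) i) = 0 :=
    Finset.prod_eq_zero (Finset.mem_univ ⟨a, ha⟩) integral_id_gaussianReal
  rw [hzero] at key
  exact key

/-- THE TWO-POINT FUNCTION OF THE REAL GAUSSIAN FIELD, off the reality pairing: coordinates with different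
representatives (different momentum pair `{p, −p}` or different label) are uncorrelated.
[cite: MagnenRivasseauSeneor1993, (II.17)–(II.18) p.332] -/
theorem integral_mul_gaussianFieldLaw_of_rep_ne (im : L → Bool) (v : Momentum × L → ℝ≥0)
    {m m' : Momentum × L} (h : rep m ≠ rep m') : ∫ A, A m * A m' ∂(gaussianFieldLaw im v) = 0 := by
  have e := integral_gmonomial_gaussianFieldLaw im v ![m, m']
  have e1 : (fun A : Momentum × L → ℝ => gmonomial ![m, m'] A) = fun A => A m * A m' := by
    funext A; simp [gmonomial, Fin.prod_univ_two]
  have e2 : (fun X : Momentum × L → ℝ => gmonomial (rep ∘ ![m, m']) X) = fun X => X (rep m) * X (rep m') := by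
    funext X; simp [gmonomial, Fin.prod_univ_two]
  rw [e1, e2, integral_mul_eval_of_ne v h, mul_zero] at e
  exact e

/-- … and on the reality pairing: coordinates with the same representative (the same coordinate, or the partner
coordinates `Re Ã(p), Re Ã(−p)` / `Im Ã(p), Im Ã(−p)`) have covariance `± v(rep m)` with the sign
`sgn m · sgn m'` (`+` for real parts, `−` for the imaginary parts at `±p`: `Ã(−p) = conj Ã(p)`).
[cite: MagnenRivasseauSeneor1993, (II.17)–(II.18) p.332, §II.A p.328 tl.12–17] -/
theorem integral_mul_gaussianFieldLaw_of_rep_eq (im : L → Bool) (v : Momentum × L → ℝ≥0)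
    {m m' : Momentum × L} (h : rep m = rep m') :
    ∫ A, A m * A m' ∂(gaussianFieldLaw im v) = sgn im m * sgn im m' * v (rep m) := by
  have e := integral_gmonomial_gaussianFieldLaw im v ![m, m']
  have e1 : (fun A : Momentum × L → ℝ => gmonomial ![m, m'] A) = fun A => A m * A m' := by
    funext A; simp [gmonomial, Fin.prod_univ_two]
  have e2 : (fun X : Momentum × L → ℝ => gmonomial (rep ∘ ![m, m']) X) = fun X => X (rep m) ^ 2 := by
    funext X; simp [gmonomial, Fin.prod_univ_two, h, sq]
  have e3 : (∏ j, sgn im (![m, m'] j)) = sgn im m * sgn im m' := by simp [Fin.prod_univ_two]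
  rw [e1, e2, e3, integral_sq_eval] at e
  exact e

end covariance

/-- **The two-point function of `dμ_{0,ρ₁}(A)` in full**: `∫ Ã_m Ã_{m'} dμ_{0,ρ₁} = 0` unless `m, m'` have the same
representative (same Lorentz/colour/real-imaginary label AND momenta equal or opposite), in which case it is
`± muZeroVariance ρ₁ m` (= `κ_{ρ₁}(|p|)C₀(p)` clipped at `0` for spatial labels, `0` for time labels) — «the
Gaussian measure with propagator C₀(p)κ_{ρ₁}(p)» read as a translation-invariant real Gaussian field, diagonal in
the labels ((II.16): `C₀⁻¹` is a scalar symbol). [cite: MagnenRivasseauSeneor1993, (II.16), (II.18) p.332] -/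
theorem integral_mul_muZero (par : Parameters) (ρ₁ : ℕ) (m m' : Mode) :
    ∫ A, A m * A m' ∂(muZero par ρ₁) =
      if rep m = rep m' then sgn modeIm m * sgn modeIm m' * (par.muZeroVariance ρ₁ m : ℝ) else 0 := by
  unfold muZero
  split_ifs with h
  · rw [integral_mul_gaussianFieldLaw_of_rep_eq modeIm _ h, muZeroVariance_rep]
  · exact integral_mul_gaussianFieldLaw_of_rep_ne modeIm _ h

/-- The same for `dν_{ρ₂}(γ)` with `Γ_{ρ₂}` ((II.36)). [cite: MagnenRivasseauSeneor1993, (II.36) p.339 tl.22–24] -/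
theorem integral_mul_nu (par : Parameters) (ρ₂ : ℕ) (m m' : GhostMode) :
    ∫ γ, γ m * γ m' ∂(nu par ρ₂) =
      if rep m = rep m' then sgn ghostIm m * sgn ghostIm m' * (par.nuVariance ρ₂ (rep m) : ℝ) else 0 := by
  unfold nu
  split_ifs with h
  · exact integral_mul_gaussianFieldLaw_of_rep_eq ghostIm _ h
  · exact integral_mul_gaussianFieldLaw_of_rep_ne ghostIm _ h

/-! ## §6 (v1.1) The TRUE cutoff on the reference structure: the two explicitly Gaussian `A′`-factors of (II.78)

In (II.78) (p.347 tl.2–7; = (II.49) p.342) the first two `A′`-factors are `dμ_{0,ρ₁}(A′)` and the true-cutoff factor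
*«e^{−(1/2)⟨A′,[(κ_ρ)⁻¹−1](p²)A′⟩}»* ((II.40) p.340: *«We impose now the true cutoff at a scale M^ρ with ρ ≪ ρ₂ ≪ ρ₁
… This true cutoff changes the formula (II.39) into (II.40)»*). Their product, normalised, is again a centred Gaussian,
with momentum symbol `[(C₀(p)κ_{ρ₁}(p))⁻¹ + ((κ_ρ(p))⁻¹ − 1)p²]⁻¹` — OUR one-line Gaussian algebra (the paper makes
the same move in words for (II.18)/(II.19): *«the Gaussian measure dμ_axial and propagators C_axial are obtained by
joining to C₀ the quadratic piece ⟨A, p₀²A⟩»*, p.332 tl.21–23), NOT a printed display; typed as a DEFINITION with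
this docstring, so that the rôle of the true cutoff `ρ` on the reference structure is visible: below `M^ρ` the
symbol is `C₀(p)` (`κ_ρ = κ_{ρ₁} = 1`), beyond `(3 + η⁻¹)M^ρ` it is `0` (`κ_ρ = 0`: the mode is suppressed). NOT
included (and not Gaussian reference data): the quadratic terms inside `e^{(1/2)(−F²_sp(A) − ⟨A,p₀²A⟩ + Σλ²⟨A,p²κ^iA⟩)}`
(the `+⟨A, C₀⁻¹A⟩` there CANCELS the form of `dμ₀` — «added and subtracted», p.331 tl.18–19) and inside `e^{CT_ρ(A′)}`
((III.1): `b_ρ∫A²/2`, …) — they belong to the density factors. -/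

namespace Parameters

variable (par : Parameters)

/-- The true-cutoff reference symbol `C_ρ(p) = [(C₀(p)κ_{ρ₁}(p))⁻¹ + ((κ_ρ(p))⁻¹ − 1)p²]⁻¹` (ours, see the section
docstring), as a function of `r = |p|`; `0` where either cutoff kills the mode. [cite: MagnenRivasseauSeneor1993, (II.40) p.340, (II.49) p.342, (II.78) p.347] -/
def trueCutoffCovariance (ρ ρ₁ : ℕ) (r : ℝ) : ℝ :=
  if par.muZeroCovariance ρ₁ r = 0 ∨ par.uvCutoff ρ r = 0 then 0
  else ((par.muZeroCovariance ρ₁ r)⁻¹ + ((par.uvCutoff ρ r)⁻¹ - 1) * r ^ 2)⁻¹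

/-- Beyond the TRUE cutoff, `|p| ≥ (3 + η⁻¹)M^ρ`, the symbol vanishes: the mode is suppressed although the fake
cutoff `ρ₁ ≫ ρ` still carries it. [cite: MagnenRivasseauSeneor1993, (II.40) p.340 tl.15–19] -/
theorem trueCutoffCovariance_eq_zero_of_ge (ρ ρ₁ : ℕ) {r : ℝ} (hr : (3 + par.η⁻¹) * (par.M : ℝ) ^ ρ ≤ r) :
    par.trueCutoffCovariance ρ ρ₁ r = 0 := by
  unfold trueCutoffCovariance
  rw [if_pos (Or.inr ((par.uvCutoff_eq_one_and_zero ρ).2 hr))]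

/-- Below the true cutoff, `|p| ≤ M^ρ`, the true-cutoff factor is trivial (`κ_ρ = 1`) and the symbol is the
propagator of `dμ_{0,ρ₁}` itself. [cite: MagnenRivasseauSeneor1993, (II.40) p.340, (II.13)–(II.14) p.331] -/
theorem trueCutoffCovariance_eq_of_le (ρ₁ : ℕ) {ρ : ℕ} {r : ℝ} (hr : r ≤ (par.M : ℝ) ^ ρ) :
    par.trueCutoffCovariance ρ ρ₁ r = par.muZeroCovariance ρ₁ r := by
  unfold trueCutoffCovariance
  have h1 : par.uvCutoff ρ r = 1 := (par.uvCutoff_eq_one_and_zero ρ).1 hr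
  by_cases h0 : par.muZeroCovariance ρ₁ r = 0
  · rw [if_pos (Or.inl h0), h0]
  · rw [if_neg (by rw [h1]; simp [h0]), h1]
    simp

/-- Mode variances of the true-cutoff reference Gaussian for the twelve-component `A′`.
[cite: MagnenRivasseauSeneor1993, (II.49) p.342, (II.78) p.347] -/
def trueCutoffVariance (ρ ρ₁ : ℕ) (m : Mode) : ℝ≥0 := (par.trueCutoffCovariance ρ ρ₁ m.1.norm).toNNReal

end Parameters

/-- `dμ_{0,ρ₁}(A′) · e^{−(1/2)⟨A′,[(κ_ρ)⁻¹−1](p²)A′⟩}`, normalised: the two explicitly Gaussian `A′`-factors of (II.78)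
with BOTH cutoffs, as a concrete probability measure on `Config` (ours by Gaussian algebra, §6 docstring).
[cite: MagnenRivasseauSeneor1993, (II.49) p.342, (II.78) p.347] -/
def muTrueCutoff (par : Parameters) (ρ ρ₁ : ℕ) : Measure Config :=
  gaussianFieldLaw modeIm (par.trueCutoffVariance ρ ρ₁)

/-- It is a probability measure. [cite: MagnenRivasseauSeneor1993, (II.78) p.347] -/
instance muTrueCutoff.isProbabilityMeasure (par : Parameters) (ρ ρ₁ : ℕ) :
    IsProbabilityMeasure (muTrueCutoff par ρ ρ₁) := by
  unfold muTrueCutoff; infer_instance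

/-- STABILISATION UNDER THE TRUE CUTOFF: for `|p| ≤ M^R` and `R ≤ ρ ≤ ρ₁` the true-cutoff symbol at `p` equals the
stable value `muZeroCovariance R |p|` — it no longer depends on `ρ` or `ρ₁`.
[cite: MagnenRivasseauSeneor1993, (II.13)–(II.18) pp.331–332, (II.40) p.340] -/
theorem trueCutoffCovariance_stable (par : Parameters) {R ρ ρ₁ : ℕ} (hR : R ≤ ρ) (hρ : ρ ≤ ρ₁) {r : ℝ}
    (hr : r ≤ (par.M : ℝ) ^ R) : par.trueCutoffCovariance ρ ρ₁ r = par.muZeroCovariance R r := by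
  have hM1 : (1 : ℝ) ≤ par.M := par.one_lt_M.le
  rw [par.trueCutoffCovariance_eq_of_le ρ₁ (hr.trans (pow_le_pow_right₀ hM1 hR)),
    muZeroCovariance_stable par (hR.trans hρ) hr]

/-- Hence along the printed regime `ρ < ρ₂(ρ) < ρ₁(ρ)` the true-cutoff variances are mode-wise eventually constant,
with the same limit `muZeroVariance′` at the stable index … [cite: MagnenRivasseauSeneor1993, p.340 tl.15, (II.78) p.347] -/
theorem trueCutoffVariance_eventually_eq (par : Parameters) (m : Mode) :
    ∀ᶠ ρ in atTop, par.trueCutoffVariance ρ (par.ρ₁ ρ) m = par.muZeroVariance' (stableIndex m) m := by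
  refine eventually_atTop.mpr ⟨stableIndex m, fun ρ hρ => ?_⟩
  have hρ₁ : ρ ≤ par.ρ₁ ρ := by
    have h1 := (par.hρ ρ).1
    have h2 := (par.hρ ρ).2
    omega
  unfold Parameters.trueCutoffVariance Parameters.muZeroVariance'
  rw [trueCutoffCovariance_stable par hρ hρ₁ (norm_le_pow_stableIndex par m)]

/-- … so **every moment of the true-cutoff reference Gaussian converges as the TRUE cutoff `ρ → ∞`** (with
`ρ₁ = ρ₁(ρ)`): the ultraviolet limit of the normalised product of the two explicitly Gaussian `A′`-factors of (II.78)
exists, mode by mode eventually constant. [cite: MagnenRivasseauSeneor1993, p.327 tl.39–41, (II.78) p.347] -/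
theorem tendsto_integral_monomial_muTrueCutoff (par : Parameters) {N : ℕ} (f : Fin N → Mode) :
    Tendsto (fun ρ => ∫ A, monomial f A ∂(muTrueCutoff par ρ (par.ρ₁ ρ))) atTop
      (𝓝 (∫ A, monomial f A ∂(gaussianFieldLaw modeIm fun m => par.muZeroVariance' (stableIndex m) m))) :=
  tendsto_integral_gmonomial_gaussianFieldLaw modeIm (fun ρ => par.trueCutoffVariance ρ (par.ρ₁ ρ)) _
    (trueCutoffVariance_eventually_eq par) f

end MainStatement

end Literature.MathematicalPhysics.QuantumFieldTheory.MagnenRivasseauSeneor1993
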